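/-
Copyright (c) 2026 the pub-hodgecm-mathlib formalisation cell (harness21).  Prover seat hodgecm-mathlib-F0P2-p11 (g4), S8 dealer R90-CS-plan (g4) S8-R254 (6) ∕ S8-R257 (1) ∕ S8-R277 (1)
«=» CUT (A), 2026-09-05: FILE 1∕2 of W1 `hUNF^φ` — the SET CHANGE OF THE SCALAR OF RECORD.  The unfolding rows (`hunfK`, ★ p864886 ∕ ★ p865072) produce the intertwining scalar
`c(S₂,T₂; z) = L^{S₂}(z−1,χ)·L^{T₂}(2z−2,χ′) ∕ (L^{S₂}(z,χ)·L^{T₂}(2z−1,χ′))` at the dischargers' place sets `(S₂, T₂) = ({w ∣ S₀}, S₀)`, while the columns of record (V3 FILE A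
`columnsFactorisedRow_of_ports`, (V) ED. 16) read it at `(S₁, T₁)` (implicit, e.g. `(ramifiedPlaces, ∅)`); for `S₁ ⊆ S₂`, `T₁ ⊆ T₂` with FINITE differences the two rows are the same
row: the finitely many local Euler factors are holomorphic non-vanishing on `{1 < Re}` and move into the amplitude.
-/
import Summits.HodgeConjecture.HodgeConjecture.Theorems.K2E1ChiScalarRatioNonvanishingU3   -- ★ `partialStandardL_valueAtUniformizer_ne_zero`, `one_lt_re_shifts`; brings ★ F0P2w `hasProd_partialStandardL_singleton`, `one_sub_mul_residueCard_cpow_neg_ne_zero`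
import Literature.NumberTheory.Automorphic.GodementJacquetPartialLProofs                  -- ★ `partialStandardL_eq_prod_mul_partialStandardL` (split off finitely many places)
import Mathlib.Analysis.Calculus.Deriv.Mul                                                -- `DifferentiableOn.fun_finsetProd`
import HarnessLib

/-!
# S8 (R)′∕(V) — `K2E1ChiScalarRatioSetChange`: MOVING THE INTERTWINING SCALAR OF AN UNFOLDING ROW BETWEEN PLACE SETS AT FINITE DISTANCE (FILE 1∕2 of W1 `hUNF^φ`)

Track B ∕ R90-TF, crux h413 = `stmt-HodgeConjecture-24833`, route of record `HCCMUnconditional`; cell `hodgecm-mathlib`, S8 «ContSpec-n½», sub-sockets (R)′ (V3 FILE A `hunfK` binder :151,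
`{S} {T′}` implicit) and (V) (ED. 16 `hunfK` binder at `(ramifiedPlaces, ∅)`); dischargers ★ p864886 `hunfK_of_core` ∕ ★ p865072 `hunfK_pureTensor_of_readings` at `({w ∣ S₀}, S₀)`.
THEOREMS ONLY (no `def`, no `instance`, no notation, no named-fact hypothesis, no `sorry`; default heartbeats); lane `--supports stmt-HodgeConjecture-24833 --as helper`; CLOSES NO SOCKET.
Generic over number fields `K` (the `χ`-field) and `K′` (the `χ′`-field).

THE MATHEMATICS ([Neukirch1999] VII §8 (8.1); [JacquetShalika1981] §1, §5 Thm 5.3; [MoeglinWaldspurger1995] II.1.7, IV.1.11).  For a unitary Hecke character `χ` every local factor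
`(1 − χ(ϖ_v) q_v^{−s})⁻¹` has `‖χ(ϖ_v)‖ = 1`, so it is holomorphic and non-zero on `{0 < Re s}` (§1), and for `S₁ ⊆ S₂` with `S₂ ∖ S₁` finite, `L^{S₁}(s,χ) = (∏_{v ∈ S₂∖S₁}(1 − χ(ϖ_v)q_v^{−s})⁻¹)
· L^{S₂}(s,χ)` on `{1 < Re s}` (§2, ★ `partialStandardL_eq_prod_mul_partialStandardL` with the absolutely convergent singleton Euler product ★ `hasProd_partialStandardL_singleton`).  Hence on
the tube `{2 < Re z}` (where `z, z−1, 2z−1, 2z−2 ∈ {1 < Re}`, ★ `one_lt_re_shifts`) `c(S₁,T₁; z) = c(S₂,T₂; z) · Q(z)⁻¹` with the EXPLICIT finite product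
`Q(z) = ∏_{v∈S₂∖S₁}(1 − χ_v q_v^{−(z−1)})(1 − χ_v q_v^{−z})⁻¹ · ∏_{v∈T₂∖T₁}(1 − χ′_v q_v^{−(2z−2)})(1 − χ′_v q_v^{−(2z−1)})⁻¹`, holomorphic on `{1 < Re}` (indeed on `{½ < Re}`; §1), so an
unfolding row `I(z) = c(S₂,T₂; z)·A(z)` (`A` holomorphic on `{1 < Re}`) is the row `I(z) = c(S₁,T₁; z)·(Q·A)(z)` (§3 HEAD).
* §1 `differentiable_one_sub_mul_residueCard_cpow_neg_comp`, `one_sub_mul_residueCard_cpow_neg_comp_ne_zero`, `differentiableOn_inv_one_sub_mul_residueCard_cpow_neg_comp`,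
  `differentiableOn_setChangeFactor`.
* §2 `partialStandardL_eq_prod_mul_of_subset_of_finite` (one `L`-value), `scalarRatio_eq_prod_mul_of_subsets` (the ratio on the tube).
* §3 HEAD **`exists_differentiableOn_scalarRatio_of_subsets`** (row at `(S₂,T₂)` ⇒ row at `(S₁,T₁)`), and the record reading **`exists_differentiableOn_scalarRatio_one_of_subsets`** (`χ′ = 1`).
HONEST LABEL: HC_CM is proved only modulo the 7 printed citations (2 remaining named inputs: hLiu418 = `stmt-HodgeConjecture-24832`, h413 = `stmt-HodgeConjecture-24833`) until rung 0
closes; REL ≠ ★ ≠ BUILT; this file asserts no named fact and closes no socket; count-neutral.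

## References
* [Neukirch1999] J. Neukirch, *Algebraic Number Theory* (1999): Ch. VII §8 Prop. (8.1).
* [JacquetShalika1981] H. Jacquet, J. Shalika, *On Euler products and the classification of automorphic representations I*, Amer. J. Math. 103 (1981): §1, §5 Thm 5.3.
* [MoeglinWaldspurger1995] C. Mœglin, J.-L. Waldspurger, *Spectral Decomposition and Eisenstein Series* (1995): II.1.7, IV.1.11.
-/

set_option autoImplicit false
set_option linter.dupNamespace false  -- the mandated namespace repeats the summit's segment (`HodgeConjecture.HodgeConjecture`)

noncomputable section

open NumberField IsDedekindDomain
open Literature.NumberTheory.Automorphic Literature.NumberTheory.GaloisRepresentations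
open Summit.HodgeConjecture.HodgeConjecture.Cruxes.H413.F0P2wPartialDedekindZetaPole (hasProd_partialStandardL_singleton one_sub_mul_residueCard_cpow_neg_ne_zero differentiable_residueCard_cpow_neg)
open Summit.HodgeConjecture.HodgeConjecture.Cruxes.H413.K2E1ChiScalarRatioNonvanishingU3 (partialStandardL_valueAtUniformizer_ne_zero one_lt_re_shifts)

namespace Summit.HodgeConjecture.HodgeConjecture.Cruxes.H413.K2E1ChiScalarRatioSetChange

/-! ## §1 One place: the factor `1 − c·q_v^{−ℓ(z)}` along a holomorphic argument `ℓ` -/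

section OnePlace

variable {K : Type} [Field K] [NumberField K]

/-- **`z ↦ 1 − c·q_v^{−ℓ(z)}` IS ENTIRE** for an entire argument `ℓ` (`q_v ≠ 0`; Mathlib `Differentiable.const_cpow`). [folklore] -/
theorem differentiable_one_sub_mul_residueCard_cpow_neg_comp (v : HeightOneSpectrum (𝓞 K)) (c : ℂ) {ℓ : ℂ → ℂ} (hℓ : Differentiable ℂ ℓ) :
    Differentiable ℂ fun z : ℂ => 1 - c * (v.residueCard : ℂ) ^ (-ℓ z) :=
  (differentiable_const (c := (1 : ℂ))).sub
    ((hℓ.neg.const_cpow (Or.inl (Nat.cast_ne_zero.mpr (zero_lt_one.trans v.one_lt_residueCard).ne'))).const_mul c)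

/-- **`1 − c·q_v^{−ℓ(z)} ≠ 0`** when `‖c‖ ≤ 1` and `0 < Re ℓ(z)` (★ `one_sub_mul_residueCard_cpow_neg_ne_zero`). [cite: Neukirch1999, VII §8 (8.1)] -/
theorem one_sub_mul_residueCard_cpow_neg_comp_ne_zero (v : HeightOneSpectrum (𝓞 K)) {c : ℂ} (hc : ‖c‖ ≤ 1) {ℓ : ℂ → ℂ} {z : ℂ} (hz : 0 < (ℓ z).re) :
    1 - c * (v.residueCard : ℂ) ^ (-ℓ z) ≠ 0 :=
  one_sub_mul_residueCard_cpow_neg_ne_zero v hc hz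

/-- **`z ↦ (1 − c·q_v^{−ℓ(z)})⁻¹` IS HOLOMORPHIC where `0 < Re ℓ(z)`** (`‖c‖ ≤ 1`). [cite: Neukirch1999, VII §8 (8.1)] -/
theorem differentiableOn_inv_one_sub_mul_residueCard_cpow_neg_comp (v : HeightOneSpectrum (𝓞 K)) {c : ℂ} (hc : ‖c‖ ≤ 1) {ℓ : ℂ → ℂ} (hℓ : Differentiable ℂ ℓ)
    {U : Set ℂ} (hU : ∀ z ∈ U, 0 < (ℓ z).re) :
    DifferentiableOn ℂ (fun z : ℂ => (1 - c * (v.residueCard : ℂ) ^ (-ℓ z))⁻¹) U :=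
  ((differentiable_one_sub_mul_residueCard_cpow_neg_comp v c hℓ).differentiableOn.inv fun z hz => one_sub_mul_residueCard_cpow_neg_comp_ne_zero v hc (hU z hz))

/-- **THE SET-CHANGE FACTOR `Q` IS HOLOMORPHIC ON `{1 < Re}`**: for unitary Hecke characters `χ` of `K`, `χ′` of `K′` and finite sets `T ⊂` places of `K`, `T′ ⊂` places of `K′`,
`Q(z) = ∏_{v∈T}(1 − χ_v q_v^{−(z−1)})(1 − χ_v q_v^{−z})⁻¹ · ∏_{v∈T′}(1 − χ′_v q_v^{−(2z−2)})(1 − χ′_v q_v^{−(2z−1)})⁻¹` is holomorphic on `{1 < Re z}` (the inverted factors have arguments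
`z`, `2z−1` of positive real part there). [cite: Neukirch1999, VII §8 (8.1)] -/
theorem differentiableOn_setChangeFactor {K' : Type} [Field K'] [NumberField K'] {χ : HeckeCharacter K} (hχ : χ.IsUnitary) {χ' : HeckeCharacter K'} (hχ' : χ'.IsUnitary)
    (T : Finset (HeightOneSpectrum (𝓞 K))) (T' : Finset (HeightOneSpectrum (𝓞 K'))) :
    DifferentiableOn ℂ (fun z : ℂ =>
      (∏ v ∈ T, (1 - χ.valueAtUniformizer v * (v.residueCard : ℂ) ^ (-(z - 1))) * (1 - χ.valueAtUniformizer v * (v.residueCard : ℂ) ^ (-z))⁻¹) *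
        ∏ v ∈ T', (1 - χ'.valueAtUniformizer v * (v.residueCard : ℂ) ^ (-(2 * z - 2))) * (1 - χ'.valueAtUniformizer v * (v.residueCard : ℂ) ^ (-(2 * z - 1)))⁻¹) {z : ℂ | 1 < z.re} := by
  have hℓ1 : Differentiable ℂ fun z : ℂ => z - 1 := differentiable_id.sub_const 1
  have hℓ0 : Differentiable ℂ fun z : ℂ => z := differentiable_id
  have hℓ22 : Differentiable ℂ fun z : ℂ => 2 * z - 2 := (differentiable_id.const_mul (2 : ℂ)).sub_const 2
  have hℓ21 : Differentiable ℂ fun z : ℂ => 2 * z - 1 := (differentiable_id.const_mul (2 : ℂ)).sub_const 1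
  have hre0 : ∀ z ∈ {z : ℂ | 1 < z.re}, 0 < (z : ℂ).re := fun z hz => by
    have h : 1 < z.re := hz
    linarith
  have hre21 : ∀ z ∈ {z : ℂ | 1 < z.re}, 0 < (2 * z - 1 : ℂ).re := fun z hz => by
    have h : 1 < z.re := hz
    have h2 : (2 * z - 1 : ℂ).re = 2 * z.re - 1 := by simp [Complex.mul_re]
    rw [h2]; linarith
  refine DifferentiableOn.mul ?_ ?_
  · refine DifferentiableOn.fun_finsetProd fun v _ => ?_
    exact ((differentiable_one_sub_mul_residueCard_cpow_neg_comp v (χ.valueAtUniformizer v) hℓ1).differentiableOn).mul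
      (differentiableOn_inv_one_sub_mul_residueCard_cpow_neg_comp v (HeckeCharacter.norm_valueAtUniformizer_of_isUnitary hχ v).le hℓ0 hre0)
  · refine DifferentiableOn.fun_finsetProd fun v _ => ?_
    exact ((differentiable_one_sub_mul_residueCard_cpow_neg_comp v (χ'.valueAtUniformizer v) hℓ22).differentiableOn).mul
      (differentiableOn_inv_one_sub_mul_residueCard_cpow_neg_comp v (HeckeCharacter.norm_valueAtUniformizer_of_isUnitary hχ' v).le hℓ21 hre21)

end OnePlace

/-! ## §2 The set change of one partial `L`-value and of the scalar ratio on the tube -/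

section SetChange

variable {K : Type} [Field K] [NumberField K]

/-- **`L^{S₁}(s,χ) = (∏_{v∈S₂∖S₁}(1 − χ(ϖ_v)q_v^{−s})⁻¹)·L^{S₂}(s,χ)`** for a unitary Hecke character `χ`, `S₁ ⊆ S₂` with `S₂ ∖ S₁` finite, and `1 < Re s` (★ `partialStandardL_eq_prod_mul_partialStandardL`
at `T := (S₂∖S₁).toFinset`, whose multipliability hypothesis is the absolutely convergent singleton Euler product ★ `hasProd_partialStandardL_singleton`; `S₁ ∪ (S₂∖S₁) = S₂`).
[cite: JacquetShalika1981, §1] [cite: Neukirch1999, VII §8 (8.1)] -/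
theorem partialStandardL_eq_prod_mul_of_subset_of_finite {χ : HeckeCharacter K} (hχ : χ.IsUnitary) {S₁ S₂ : Set (HeightOneSpectrum (𝓞 K))} (h12 : S₁ ⊆ S₂) (hfin : (S₂ \ S₁).Finite)
    {s : ℂ} (hs : 1 < s.re) :
    partialStandardL S₁ (fun v => {χ.valueAtUniformizer v}) s =
      (∏ v ∈ hfin.toFinset, (1 - χ.valueAtUniformizer v * (v.residueCard : ℂ) ^ (-s))⁻¹) * partialStandardL S₂ (fun v => {χ.valueAtUniformizer v}) s := by
  classical
  have hT : ∀ v ∈ hfin.toFinset, v ∉ S₁ := fun v hv => (hfin.mem_toFinset.1 hv).2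
  have hU : S₁ ∪ (↑hfin.toFinset : Set (HeightOneSpectrum (𝓞 K))) = S₂ := by
    rw [Set.Finite.coe_toFinset, Set.union_sdiff_cancel h12]
  have hmul : Multipliable fun v : {v : HeightOneSpectrum (𝓞 K) // v ∉ S₁ ∪ (↑hfin.toFinset : Set (HeightOneSpectrum (𝓞 K)))} =>
      ((eulerPolynomial ({χ.valueAtUniformizer v.1} : Multiset ℂ)).eval ((v.1.residueCard : ℂ) ^ (-s)))⁻¹ := by
    have h := (hasProd_partialStandardL_singleton (S := S₁ ∪ (↑hfin.toFinset : Set (HeightOneSpectrum (𝓞 K)))) (fun v => χ.valueAtUniformizer v)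
      (fun v _ => (HeckeCharacter.norm_valueAtUniformizer_of_isUnitary hχ v).le) hs).1.multipliable
    refine h.congr fun v => ?_
    rw [eval_eulerPolynomial_singleton]
  rw [partialStandardL_eq_prod_mul_partialStandardL hT (fun v => ({χ.valueAtUniformizer v} : Multiset ℂ)) hmul, hU]
  congr 1
  exact Finset.prod_congr rfl fun v _ => by rw [eval_eulerPolynomial_singleton]

/-- **THE SCALAR RATIO AT `(S₁,T₁)` VS `(S₂,T₂)` ON THE TUBE**: for unitary `χ`, `χ′`, `S₁ ⊆ S₂`, `T₁ ⊆ T₂` with finite differences and `2 < Re z`,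
`c(S₁,T₁; z) · Q(z) = c(S₂,T₂; z)` where `c(S,T; z) = L^S(z−1,χ)L^T(2z−2,χ′) ∕ (L^S(z,χ)L^T(2z−1,χ′))` and `Q` is §1's set-change factor over `S₂∖S₁`, `T₂∖T₁` (§2 four times; all eight
`L`-values and all local factors are non-zero on the tube). [cite: MoeglinWaldspurger1995, IV.1.11] [cite: Neukirch1999, VII §8 (8.1)] -/
theorem scalarRatio_eq_prod_mul_of_subsets {K' : Type} [Field K'] [NumberField K'] {χ : HeckeCharacter K} (hχ : χ.IsUnitary) {χ' : HeckeCharacter K'} (hχ' : χ'.IsUnitary)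
    {S₁ S₂ : Set (HeightOneSpectrum (𝓞 K))} (h12 : S₁ ⊆ S₂) (hfin : (S₂ \ S₁).Finite)
    {T₁ T₂ : Set (HeightOneSpectrum (𝓞 K'))} (hT12 : T₁ ⊆ T₂) (hTfin : (T₂ \ T₁).Finite) {z : ℂ} (hz : 2 < z.re) :
    (partialStandardL S₁ (fun w => {χ.valueAtUniformizer w}) (z - 1) * partialStandardL T₁ (fun v => {χ'.valueAtUniformizer v}) (2 * z - 2)) /
        (partialStandardL S₁ (fun w => {χ.valueAtUniformizer w}) z * partialStandardL T₁ (fun v => {χ'.valueAtUniformizer v}) (2 * z - 1)) *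
      ((∏ v ∈ hfin.toFinset, (1 - χ.valueAtUniformizer v * (v.residueCard : ℂ) ^ (-(z - 1))) * (1 - χ.valueAtUniformizer v * (v.residueCard : ℂ) ^ (-z))⁻¹) *
        ∏ v ∈ hTfin.toFinset, (1 - χ'.valueAtUniformizer v * (v.residueCard : ℂ) ^ (-(2 * z - 2))) * (1 - χ'.valueAtUniformizer v * (v.residueCard : ℂ) ^ (-(2 * z - 1)))⁻¹) =
    (partialStandardL S₂ (fun w => {χ.valueAtUniformizer w}) (z - 1) * partialStandardL T₂ (fun v => {χ'.valueAtUniformizer v}) (2 * z - 2)) /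
        (partialStandardL S₂ (fun w => {χ.valueAtUniformizer w}) z * partialStandardL T₂ (fun v => {χ'.valueAtUniformizer v}) (2 * z - 1)) := by
  obtain ⟨h1, h2, h3, h4⟩ := one_lt_re_shifts hz
  -- the four set changes
  rw [partialStandardL_eq_prod_mul_of_subset_of_finite hχ h12 hfin h1, partialStandardL_eq_prod_mul_of_subset_of_finite hχ h12 hfin h3,
    partialStandardL_eq_prod_mul_of_subset_of_finite hχ' hT12 hTfin h2, partialStandardL_eq_prod_mul_of_subset_of_finite hχ' hT12 hTfin h4]
  -- names
  set L1 := partialStandardL S₂ (fun w => {χ.valueAtUniformizer w}) (z - 1)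
  set L2 := partialStandardL T₂ (fun v => {χ'.valueAtUniformizer v}) (2 * z - 2)
  set L3 := partialStandardL S₂ (fun w => {χ.valueAtUniformizer w}) z
  set L4 := partialStandardL T₂ (fun v => {χ'.valueAtUniformizer v}) (2 * z - 1)
  -- local factors are non-zero on the tube
  have hre1 : 0 < (z - 1).re := by linarith
  have hre0 : 0 < z.re := by linarith
  have hre22 : 0 < (2 * z - 2).re := by linarith
  have hre21 : 0 < (2 * z - 1).re := by linarith
  have hχle : ∀ v, ‖χ.valueAtUniformizer v‖ ≤ 1 := fun v => (HeckeCharacter.norm_valueAtUniformizer_of_isUnitary hχ v).le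
  have hχ'le : ∀ v, ‖χ'.valueAtUniformizer v‖ ≤ 1 := fun v => (HeckeCharacter.norm_valueAtUniformizer_of_isUnitary hχ' v).le
  have hL3 : L3 ≠ 0 := partialStandardL_valueAtUniformizer_ne_zero S₂ hχ h3
  have hL4 : L4 ≠ 0 := partialStandardL_valueAtUniformizer_ne_zero T₂ hχ' h4
  -- per place: `(1 − a)⁻¹ · ((1 − a)(1 − b)⁻¹) = (1 − b)⁻¹`, so the products telescope factorwise
  have hS : (∏ v ∈ hfin.toFinset, (1 - χ.valueAtUniformizer v * (v.residueCard : ℂ) ^ (-(z - 1)))⁻¹) *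
      (∏ v ∈ hfin.toFinset, (1 - χ.valueAtUniformizer v * (v.residueCard : ℂ) ^ (-(z - 1))) * (1 - χ.valueAtUniformizer v * (v.residueCard : ℂ) ^ (-z))⁻¹) =
      ∏ v ∈ hfin.toFinset, (1 - χ.valueAtUniformizer v * (v.residueCard : ℂ) ^ (-z))⁻¹ := by
    rw [← Finset.prod_mul_distrib]
    refine Finset.prod_congr rfl fun v _ => ?_
    rw [← mul_assoc, inv_mul_cancel₀ (one_sub_mul_residueCard_cpow_neg_ne_zero v (hχle v) hre1), one_mul]
  have hT : (∏ v ∈ hTfin.toFinset, (1 - χ'.valueAtUniformizer v * (v.residueCard : ℂ) ^ (-(2 * z - 2)))⁻¹) *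
      (∏ v ∈ hTfin.toFinset, (1 - χ'.valueAtUniformizer v * (v.residueCard : ℂ) ^ (-(2 * z - 2))) * (1 - χ'.valueAtUniformizer v * (v.residueCard : ℂ) ^ (-(2 * z - 1)))⁻¹) =
      ∏ v ∈ hTfin.toFinset, (1 - χ'.valueAtUniformizer v * (v.residueCard : ℂ) ^ (-(2 * z - 1)))⁻¹ := by
    rw [← Finset.prod_mul_distrib]
    refine Finset.prod_congr rfl fun v _ => ?_
    rw [← mul_assoc, inv_mul_cancel₀ (one_sub_mul_residueCard_cpow_neg_ne_zero v (hχ'le v) hre22), one_mul]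
  have hP3 : (∏ v ∈ hfin.toFinset, (1 - χ.valueAtUniformizer v * (v.residueCard : ℂ) ^ (-z))⁻¹) ≠ 0 :=
    Finset.prod_ne_zero_iff.2 fun v _ => inv_ne_zero (one_sub_mul_residueCard_cpow_neg_ne_zero v (hχle v) hre0)
  have hP4 : (∏ v ∈ hTfin.toFinset, (1 - χ'.valueAtUniformizer v * (v.residueCard : ℂ) ^ (-(2 * z - 1)))⁻¹) ≠ 0 :=
    Finset.prod_ne_zero_iff.2 fun v _ => inv_ne_zero (one_sub_mul_residueCard_cpow_neg_ne_zero v (hχ'le v) hre21)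
  set P1 := ∏ v ∈ hfin.toFinset, (1 - χ.valueAtUniformizer v * (v.residueCard : ℂ) ^ (-(z - 1)))⁻¹
  set P2 := ∏ v ∈ hTfin.toFinset, (1 - χ'.valueAtUniformizer v * (v.residueCard : ℂ) ^ (-(2 * z - 2)))⁻¹
  set P3 := ∏ v ∈ hfin.toFinset, (1 - χ.valueAtUniformizer v * (v.residueCard : ℂ) ^ (-z))⁻¹
  set P4 := ∏ v ∈ hTfin.toFinset, (1 - χ'.valueAtUniformizer v * (v.residueCard : ℂ) ^ (-(2 * z - 1)))⁻¹
  set Q1 := ∏ v ∈ hfin.toFinset, (1 - χ.valueAtUniformizer v * (v.residueCard : ℂ) ^ (-(z - 1))) * (1 - χ.valueAtUniformizer v * (v.residueCard : ℂ) ^ (-z))⁻¹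
  set Q2 := ∏ v ∈ hTfin.toFinset, (1 - χ'.valueAtUniformizer v * (v.residueCard : ℂ) ^ (-(2 * z - 2))) * (1 - χ'.valueAtUniformizer v * (v.residueCard : ℂ) ^ (-(2 * z - 1)))⁻¹
  -- `(P1 L1 · P2 L2)/(P3 L3 · P4 L4) · (Q1 Q2) = (L1 L2)/(L3 L4)` from `P1·Q1 = P3`, `P2·Q2 = P4`
  calc P1 * L1 * (P2 * L2) / (P3 * L3 * (P4 * L4)) * (Q1 * Q2)
      = (P1 * Q1) * (P2 * Q2) * (L1 * L2) / (P3 * P4 * (L3 * L4)) := by ring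
    _ = P3 * P4 * (L1 * L2) / (P3 * P4 * (L3 * L4)) := by rw [hS, hT]
    _ = L1 * L2 / (L3 * L4) := by rw [mul_div_mul_left _ _ (mul_ne_zero hP3 hP4)]

end SetChange

/-! ## §3 HEADS: an unfolding row at `(S₂,T₂)` is an unfolding row at `(S₁,T₁)` -/

section Heads

variable {K K' : Type} [Field K] [NumberField K] [Field K'] [NumberField K']

/-- **HEAD — SET CHANGE OF AN UNFOLDING ROW.**  Let `χ`, `χ′` be unitary Hecke characters of `K`, `K′`, `S₁ ⊆ S₂` and `T₁ ⊆ T₂` place sets with FINITE differences, and `I : ℂ → ℂ` any row (e.g.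
`z ↦ ∫_{N(𝔸)} φ_z(ι(w₀)·v·k) dν`).  If `I(z) = c(S₂,T₂; z)·A(z)` on `{2 < Re z}` with `A` holomorphic on `{1 < Re}` (the dischargers' row: ★ p864886 ∕ ★ p865072 at `({w ∣ S₀}, S₀)`), then
`I(z) = c(S₁,T₁; z)·A′(z)` on `{2 < Re z}` with `A′ := Q·A` holomorphic on `{1 < Re}` (the row of record: V3 FILE A's `hunfK` binder ∕ (V) ED. 16 at `(ramifiedPlaces, ∅)`), `Q` = §1's factor.
[cite: MoeglinWaldspurger1995, II.1.7, IV.1.11] [cite: Neukirch1999, VII §8 (8.1)] -/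
theorem exists_differentiableOn_scalarRatio_of_subsets {χ : HeckeCharacter K} (hχ : χ.IsUnitary) {χ' : HeckeCharacter K'} (hχ' : χ'.IsUnitary)
    {S₁ S₂ : Set (HeightOneSpectrum (𝓞 K))} (h12 : S₁ ⊆ S₂) (hfin : (S₂ \ S₁).Finite)
    {T₁ T₂ : Set (HeightOneSpectrum (𝓞 K'))} (hT12 : T₁ ⊆ T₂) (hTfin : (T₂ \ T₁).Finite) (I : ℂ → ℂ)
    (h : ∃ A : ℂ → ℂ, DifferentiableOn ℂ A {z : ℂ | 1 < z.re} ∧ ∀ z : ℂ, 2 < z.re →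
      I z = ((partialStandardL S₂ (fun w => {χ.valueAtUniformizer w}) (z - 1) * partialStandardL T₂ (fun v => {χ'.valueAtUniformizer v}) (2 * z - 2)) /
        (partialStandardL S₂ (fun w => {χ.valueAtUniformizer w}) z * partialStandardL T₂ (fun v => {χ'.valueAtUniformizer v}) (2 * z - 1))) * A z) :
    ∃ A' : ℂ → ℂ, DifferentiableOn ℂ A' {z : ℂ | 1 < z.re} ∧ ∀ z : ℂ, 2 < z.re →
      I z = ((partialStandardL S₁ (fun w => {χ.valueAtUniformizer w}) (z - 1) * partialStandardL T₁ (fun v => {χ'.valueAtUniformizer v}) (2 * z - 2)) /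
        (partialStandardL S₁ (fun w => {χ.valueAtUniformizer w}) z * partialStandardL T₁ (fun v => {χ'.valueAtUniformizer v}) (2 * z - 1))) * A' z := by
  obtain ⟨A, hA, hI⟩ := h
  refine ⟨fun z => ((∏ v ∈ hfin.toFinset, (1 - χ.valueAtUniformizer v * (v.residueCard : ℂ) ^ (-(z - 1))) * (1 - χ.valueAtUniformizer v * (v.residueCard : ℂ) ^ (-z))⁻¹) *
      ∏ v ∈ hTfin.toFinset, (1 - χ'.valueAtUniformizer v * (v.residueCard : ℂ) ^ (-(2 * z - 2))) * (1 - χ'.valueAtUniformizer v * (v.residueCard : ℂ) ^ (-(2 * z - 1)))⁻¹) * A z,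
    (differentiableOn_setChangeFactor hχ hχ' hfin.toFinset hTfin.toFinset).mul hA, fun z hz => ?_⟩
  rw [hI z hz, ← scalarRatio_eq_prod_mul_of_subsets hχ hχ' h12 hfin hT12 hTfin hz]
  ring

/-- **HEAD, RECORD READING (`χ′ = 1`, the trivial Hecke character of `K′ = L⁺`, unitary by ★ `HeckeCharacter.isUnitary_one`)**: the same set change for rows whose `ζ`-part is written with
`(1 : HeckeCharacter K′).valueAtUniformizer` — the bytes of V3 FILE A's `hunfK` binder and of (V) ED. 16. [cite: MoeglinWaldspurger1995, IV.1.11] [cite: Neukirch1999, VII §8 (8.1)] -/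
theorem exists_differentiableOn_scalarRatio_one_of_subsets {χ : HeckeCharacter K} (hχ : χ.IsUnitary)
    {S₁ S₂ : Set (HeightOneSpectrum (𝓞 K))} (h12 : S₁ ⊆ S₂) (hfin : (S₂ \ S₁).Finite)
    {T₁ T₂ : Set (HeightOneSpectrum (𝓞 K'))} (hT12 : T₁ ⊆ T₂) (hTfin : (T₂ \ T₁).Finite) (I : ℂ → ℂ)
    (h : ∃ A : ℂ → ℂ, DifferentiableOn ℂ A {z : ℂ | 1 < z.re} ∧ ∀ z : ℂ, 2 < z.re →
      I z = ((partialStandardL S₂ (fun w => {χ.valueAtUniformizer w}) (z - 1) * partialStandardL T₂ (fun v => {(1 : HeckeCharacter K').valueAtUniformizer v}) (2 * z - 2)) /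
        (partialStandardL S₂ (fun w => {χ.valueAtUniformizer w}) z * partialStandardL T₂ (fun v => {(1 : HeckeCharacter K').valueAtUniformizer v}) (2 * z - 1))) * A z) :
    ∃ A' : ℂ → ℂ, DifferentiableOn ℂ A' {z : ℂ | 1 < z.re} ∧ ∀ z : ℂ, 2 < z.re →
      I z = ((partialStandardL S₁ (fun w => {χ.valueAtUniformizer w}) (z - 1) * partialStandardL T₁ (fun v => {(1 : HeckeCharacter K').valueAtUniformizer v}) (2 * z - 2)) /
        (partialStandardL S₁ (fun w => {χ.valueAtUniformizer w}) z * partialStandardL T₁ (fun v => {(1 : HeckeCharacter K').valueAtUniformizer v}) (2 * z - 1))) * A' z :=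
  exists_differentiableOn_scalarRatio_of_subsets hχ HeckeCharacter.isUnitary_one h12 hfin hT12 hTfin I h

end Heads

end Summit.HodgeConjecture.HodgeConjecture.Cruxes.H413.K2E1ChiScalarRatioSetChange

end
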